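import Summits.QuantumFields.YangMills.Theorems.BalabanUVNodesN15NeumannCubeLift
import Summits.QuantumFields.YangMills.Theorems.BalabanUVNodesN15NeumannCubeGradient
import Summits.QuantumFields.YangMills.Theorems.BalabanUVNodesN15NeumannCubeConvolution
import Summits.QuantumFields.YangMills.Theorems.BalabanUVNodesN15TwoGridLandauReduction
import HarnessLib

/-!
# Route «BalabanUVNodes» (K3⁷), node N15 = NE2, -a lane, PROGRAMME P file P-IIb: THE ROWS OF THE LIFTED NEUMANN CUBE PROPAGATOR ON THE TORUS FAMILY OF RECORD —
# `hGc`, the gradient row `hDc`, the nonlocal Landau row `hNc`, the exact `hloc` — cube side `L^s` FIXED, volume `M_ν = 2L^{m_T}` FREE, programme N's constants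

Cell `pub-ymgap`, seat `pub-ymgap-dag-n15-a` (KNIT-BY-NAME, g20; D-0062; chair R424 venue; `bears_on: R4∕N15`); `--kind proof --supports stmt-QuantumFields-20544 --as helper`.
Sequel of P-IIa `…N15NeumannCubeLift` (`liftCubeG`, exact locality, `hasMaj_transplant_of_blockMap`, cube geometry under `π`) over programme N's rows on the doubled tori: N-IIIb
`hasMaj_chiCube_neumannCubeG`, N-IIIc `hasMaj_chiCube_grad_neumannCubeG`, N-IIi `hasMaj_chiCube_comp_neumannCubeG` (+ part 39 `hasMaj_gOp`, part 47 `hasMaj_landauRe`).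
CONSUMER: dag-n15-c's gluing on the torus of record (`hasMaj_(idef_)glued_of_cutRows`: rows `hGc`, `hDc`∕`hDbc` via `hasMaj_commOp_lapOp_comp_of_cut`, `hNc` via N-IIj's split).

WHAT.  §9 the generic lift `liftOp X′ := π^* ∘ X′ ∘ ρ_{W,π}` (`liftCubeG = liftOp G(□′)`), ★ `mulOp_chiCube_comp_liftOp` (cut lift = the lit's `transplant`), ★ `comp_liftOp_of_comm` (an operator
that DESCENDS slips inside the lift), `liftOp_comp_mulOp_chiCube` (the small-torus source cut is invisible), and three DESCENTS: ★ `symbOp_sD_comp_pullVR` (forward difference),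
★ `symbOp_divAdj_comp_pullVR` (adjoint difference), ★ `landauRe_comp_pullVR` (the Landau term `∂Π∂*` of (1.69), from P-Ib's complex intertwiners); COHERENCE ★ `liftCubeG_self`
(`M′ = M`, `π = id` ⟹ the lift IS programme N's `neumannCubeG`: positive control).  §10 on `MP (paramsOf d L m_T K hL)` with the
cube torus `MP (paramsOf d L s K hL)`, `s ≤ m_T` (`MP_dvd_MP`): ★★ `hasMaj_transplant_cube_family` (ANY small-torus operator with a cube-cut letter `1_{□′}1_{□′}βe^{−δd′}` transplants with the
SAME letter in the big distance), ★★★ `hasMaj_chiCube_liftCubeG` (`hGc`, N-IIIb's `δ, β`), ★★★ `hasMaj_chiCube_grad_liftCubeG` (`hDc`, N-IIIc's), ★★ `hasMaj_chiCube_landauRe_liftCubeG`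
(`hNc` with the BIG torus's `∂Π∂*`, N-IIi's shape `2^{d+1}C₁(Ce^{δ₀})c_r·e^{−ρd}`), ★★★ `mulOp_comp_deltaOp_comp_liftCubeG_family` (FILE 45's `hloc` EXACT) — all UNIFORM in `m_T ≥ s`.
HONEST FRAMING.  Count-neutral; finite lattice algebra + block-majorant bookkeeping over LANDED rows (no new analytic estimate: [B5] Prop. 1.2 (1.110) and (1.126)–(1.128) through programme N);
`U ≡ 1` torus MODEL of [B5] §1; the lift's output is the `2L^s`-periodic images extension (only cut rows are physical — what the gluing consumes); the entry-2 rows and the two-grid η-defects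
of the lifted cubes are the sequel P-IIc; nothing of [B6] (2.38)–(2.40)∕[B9] asserted; NE2⁺ NOT PRINTED; N15 NOT discharged (object-bound); counts UNMOVED (typed 28∕28 · discharged 5∕27);
finite tori at fixed lattice spacing — NOT continuum ∕ ℝ⁴ ∕ OS ∕ mass gap ∕ Clay.  Plumbing def is DATA (`liftOp`); every theorem is [folklore] lattice algebra ∕ bookkeeping about printed objects.
-/

noncomputable section

open scoped BigOperators Matrix
open Finset

namespace Summit.QuantumFields.YangMills.BalabanUVNodes.N15.TwoGrid

open Literature.MathematicalPhysics.QuantumFieldTheory.Balaban1983to89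
open Literature.MathematicalPhysics.QuantumFieldTheory.Balaban1983to89.B5Prop11Plancherel (Tor fine unitVec)
open Literature.MathematicalPhysics.QuantumFieldTheory.Balaban1983to89.B5Block118 (tstep up upHom iota bpt)
open Literature.MathematicalPhysics.QuantumFieldTheory.Balaban1983to89.B5SiteBridgeP12 (MP)

variable {d : ℕ}

/-! ## §9 The generic lift of a small-torus operator, its cut = the transplant, descent of the difference symbols and of the Landau term -/

section LiftOp

open Literature.MathematicalPhysics.QuantumFieldTheory.Balaban1983to89.B6Prop26Gluing (mulOp mulOp_apply ind ind_nonneg ind_le_one)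
open Literature.MathematicalPhysics.QuantumFieldTheory.Balaban1983to89.B6Prop26ReachTransplant (restrictOp extendOp transplant restrictOp_apply restrictOp_apply_of_injOn
  restrictOp_apply_of_not_mem extendOp_apply transplant_apply)
open Literature.MathematicalPhysics.QuantumFieldTheory.King1986.Torus (blockOf tdistT)
open Literature.MathematicalPhysics.QuantumFieldTheory.Balaban1983to89.B5Action121 (GradOp)
open Literature.MathematicalPhysics.QuantumFieldTheory.Balaban1983to89.B5Value126 (PcT)
open Literature.MathematicalPhysics.QuantumFieldTheory.Balaban1983to89.B5RealFields (IsReal reM)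

variable (n : ℕ) [NeZero n] {M M' : Fin (d + 1) → ℕ} [∀ μ, NeZero (M μ)] [∀ μ, NeZero (M' μ)] (hM : ∀ μ, M' μ ∣ M μ) (c : Tor M) (S : ℕ)

/-- **THE LIFT OF AN OPERATOR OF THE SMALL TORUS** to the big one through the cube `□ + c`: `X^{↑} := π^* ∘ X′ ∘ ρ_{W,π}` (source restricted to the cube's bonds and read on the image
cube, output pulled back = periodic images). [cite: Balaban1984PropagatorsII, p.238 (T_□), (2.90)–(2.91) p.239] -/
def liftOp (X' : Module.End ℝ (Tor (fine n M') × Fin (d + 1) → ℝ)) : Module.End ℝ (Tor (fine n M) × Fin (d + 1) → ℝ) :=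
  pullVR n hM ∘ₗ X' ∘ₗ restrictOp (cubeW n c S) (redBond n hM)

/-- the lifted cube propagator is the lift of programme N's cube propagator. [folklore] -/
theorem liftCubeG_eq_liftOp (a : ℝ) : liftCubeG n hM c S a = liftOp n hM c S (neumannCubeG M' n (torRed hM c) S a) := rfl

/-- ★ the CUT lift is the lit's transplant: `M_{χ_□} ∘ X^{↑} = transplant W π X′`. [cite: Balaban1984PropagatorsII, (2.90)–(2.91) p.239, (2.133) p.247] -/
theorem mulOp_chiCube_comp_liftOp (X' : Module.End ℝ (Tor (fine n M') × Fin (d + 1) → ℝ)) :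
    mulOp (chiCube M n c S) ∘ₗ liftOp n hM c S X' = transplant (cubeW n c S) (redBond n hM) X' := by
  refine LinearMap.ext fun f => funext fun b => ?_
  obtain ⟨x, μ⟩ := b
  rw [LinearMap.comp_apply, mulOp_apply, liftOp, LinearMap.comp_apply, LinearMap.comp_apply, pullVR_apply, transplant_apply, chiCube_eq_ite]
  split_ifs <;> simp [redBond]

/-- an operator of the big torus that DESCENDS slips inside the lift: `A ∘ π^* = π^* ∘ A′ ⟹ A ∘ X^{↑} = (A′ ∘ X′)^{↑}`. [folklore] -/
theorem comp_liftOp_of_comm {A : Module.End ℝ (Tor (fine n M) × Fin (d + 1) → ℝ)} {A' : Module.End ℝ (Tor (fine n M') × Fin (d + 1) → ℝ)}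
    (h : A ∘ₗ pullVR n hM = pullVR n hM ∘ₗ A') (X' : Module.End ℝ (Tor (fine n M') × Fin (d + 1) → ℝ)) : A ∘ₗ liftOp n hM c S X' = liftOp n hM c S (A' ∘ₗ X') := by
  rw [liftOp, liftOp, ← LinearMap.comp_assoc _ (pullVR n hM) A, h]
  simp only [LinearMap.comp_assoc]

/-- a source cut by a multiplier equal to `1` on the image of the window is invisible behind the restriction. [folklore] -/
theorem mulOp_comp_restrictOp_of_eq_one {X X' : Type} [DecidableEq X'] {W : Finset X} {e : X → X'} {χ : X' → ℝ} (hχ : ∀ x ∈ W, χ (e x) = 1) :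
    mulOp χ ∘ₗ restrictOp W e = restrictOp W e := by
  refine LinearMap.ext fun f => funext fun x' => ?_
  rw [LinearMap.comp_apply, mulOp_apply]
  by_cases hx : ∃ x ∈ W, e x = x'
  · obtain ⟨x, hxW, rfl⟩ := hx
    rw [hχ x hxW, one_mul]
  · rw [restrictOp_apply_of_not_mem f fun x hxW hxe => hx ⟨x, hxW, hxe⟩, mul_zero]

/-- hence the lift does not see a source cut by `χ_{□′}`. [folklore] -/
theorem liftOp_comp_mulOp_chiCube (hS : ∀ ν, S ≤ M' ν) (X' : Module.End ℝ (Tor (fine n M') × Fin (d + 1) → ℝ)) :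
    liftOp n hM c S (X' ∘ₗ mulOp (chiCube M' n (torRed hM c) S)) = liftOp n hM c S X' := by
  rw [liftOp, liftOp]
  simp only [LinearMap.comp_assoc, mulOp_comp_restrictOp_of_eq_one (fun b hb => chiCube_redBond_of_mem (n := n) (hM := hM) (c := c) (S := S) hS hb)]

omit [∀ μ, NeZero (M μ)] in
/-- ★ DESCENT OF THE FORWARD DIFFERENCE: `ρ_M(c(s_ν − 1)) ∘ π^* = π^* ∘ ρ_{M′}(c(s_ν − 1))`. [cite: Balaban1984PropagatorsI, (1.31) p.23] -/
theorem symbOp_sD_comp_pullVR (ν : Fin (d + 1)) (cc : ℝ) : symbOp M n (sD M n ν cc) ∘ₗ pullVR n hM = pullVR n hM ∘ₗ symbOp M' n (sD M' n ν cc) := by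
  refine LinearMap.ext fun A => funext fun b => ?_
  obtain ⟨x, μ⟩ := b
  rw [LinearMap.comp_apply, LinearMap.comp_apply, symbOp_sD_apply, pullVR_apply, pullVR_apply, pullVR_apply, symbOp_sD_apply, torRed_add_unitVec]

omit [∀ μ, NeZero (M μ)] in
/-- ★ DESCENT OF THE ADJOINT DIFFERENCE: `ρ_M(c(s_ν⁻¹ − 1)) ∘ π^* = π^* ∘ ρ_{M′}(c(s_ν⁻¹ − 1))`. [cite: Balaban1984PropagatorsI, Prop. 1.2 (1.110) p.35 (entry «G∇*»)] -/
theorem symbOp_divAdj_comp_pullVR (ν : Fin (d + 1)) (cc : ℝ) :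
    symbOp M n (cc • (sTinv M n ν - 1)) ∘ₗ pullVR n hM = pullVR n hM ∘ₗ symbOp M' n (cc • (sTinv M' n ν - 1)) := by
  refine LinearMap.ext fun A => funext fun b => ?_
  obtain ⟨x, μ⟩ := b
  rw [LinearMap.comp_apply, LinearMap.comp_apply, symbOp_divAdj_apply, pullVR_apply, pullVR_apply, pullVR_apply, symbOp_divAdj_apply, torRed_sub_unitVec]

/-- ★ DESCENT OF THE LANDAU TERM `∂Π∂*` of `Δ_a` (1.69): `V_M ∘ π^* = π^* ∘ V_{M′}`. [cite: Balaban1984PropagatorsI, (1.69) p.29, (1.70) p.30] -/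
theorem landauRe_comp_pullVR : landauRe M n ∘ₗ pullVR n hM = pullVR n hM ∘ₗ landauRe M' n := by
  have hc : (n : ℂ) ≠ 0 := Nat.cast_ne_zero.mpr (NeZero.ne n)
  have t2 : GradOp (fine n M) (n : ℂ) * PcT n M (n : ℂ) * (GradOp (fine n M) (n : ℂ))ᴴ * pullV (fine_dvd n hM)
      = pullV (fine_dvd n hM) * (GradOp (fine n M') (n : ℂ) * PcT n M' (n : ℂ) * (GradOp (fine n M') (n : ℂ))ᴴ) := by
    rw [Matrix.mul_assoc, Matrix.mul_assoc, GradOp_conjTranspose_mul_pullV, ← Matrix.mul_assoc (PcT n M _), PcT_mul_pullS n hM _ hc, Matrix.mul_assoc,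
      ← Matrix.mul_assoc, ← Matrix.mul_assoc, GradOp_mul_pullS, Matrix.mul_assoc, Matrix.mul_assoc, Matrix.mul_assoc]
  have tR : reM (GradOp (fine n M) (n : ℂ) * PcT n M (n : ℂ) * (GradOp (fine n M) (n : ℂ))ᴴ) * reM (pullV (fine_dvd n hM))
      = reM (pullV (fine_dvd n hM)) * reM (GradOp (fine n M') (n : ℂ) * PcT n M' (n : ℂ) * (GradOp (fine n M') (n : ℂ))ᴴ) := by
    rw [← IsReal.reM_mul (isReal_landauMatrix M n) (isReal_pullV _), ← IsReal.reM_mul (isReal_pullV _) (isReal_landauMatrix M' n), t2]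
  rw [landauRe, landauRe, pullVR, ← Matrix.mulVecLin_mul, ← Matrix.mulVecLin_mul, tR]

/-! ### Coherence at equal tori: the lift through the identity periodisation IS programme N's cube propagator -/

/-- the periodisation along `M′ = M` is the identity. [folklore] -/
theorem torRed_self {N : Fin (d + 1) → ℕ} (x : Tor N) : torRed (fun _ => dvd_rfl : ∀ μ, N μ ∣ N μ) x = x := by
  funext μ; rw [torRed_apply, ZMod.castHom_apply, ZMod.cast_id]

/-- `π^* = id` at equal tori. [folklore] -/
theorem pullVR_self (A : Tor (fine n M) × Fin (d + 1) → ℝ) : pullVR n (fun _ => dvd_rfl : ∀ μ, M μ ∣ M μ) A = A := by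
  funext i; obtain ⟨x, μ⟩ := i
  rw [pullVR_apply]
  exact congrArg (fun z => A (z, μ)) (torRed_self x)

/-- ★ **COHERENCE (positive control)**: on ONE torus (`M′ = M`, `π = id`) the lift of the images cube propagator through the cube's bonds IS programme N's `neumannCubeG` — the source cut by the cube's
bonds is invisible behind `χ°` (`intBonds ⊆ cubeW`). [cite: Balaban1984PropagatorsII, (2.37) p.229] -/
theorem liftCubeG_self (a : ℝ) : liftCubeG n (fun _ => dvd_rfl : ∀ μ, M μ ∣ M μ) c S a = neumannCubeG M n c S a := by
  refine LinearMap.ext fun f => funext fun b => ?_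
  rw [liftCubeG_apply]
  have hb : redBond n (fun _ => dvd_rfl : ∀ μ, M μ ∣ M μ) b = b := Prod.ext (torRed_self b.1) rfl
  have hc : torRed (fun _ => dvd_rfl : ∀ μ, M μ ∣ M μ) c = c := torRed_self c
  rw [hb, hc]
  -- the restriction along the identity chart is the cut by the window, invisible behind `χ°`
  have hρ : ∀ g : Tor (fine n M) × Fin (d + 1) → ℝ, mulOp (chiInt M n c S) (restrictOp (cubeW n c S) (redBond n (fun _ => dvd_rfl : ∀ μ, M μ ∣ M μ)) g) =
      mulOp (chiInt M n c S) g := by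
    intro g; funext b'
    rw [mulOp_apply, mulOp_apply]
    by_cases hb' : b' ∈ intBonds M n c S
    · have hW : b' ∈ cubeW n c S := mem_cubeW_of_mem_intBonds hb'
      have hinj : Set.InjOn (redBond n (fun _ => dvd_rfl : ∀ μ, M μ ∣ M μ)) ↑(cubeW n c S) := fun x _ y _ h => by
        have h1 := congrArg Prod.fst h; have h2 := congrArg Prod.snd h
        simp only [redBond, torRed_self] at h1
        exact Prod.ext h1 h2
      have e : redBond n (fun _ => dvd_rfl : ∀ μ, M μ ∣ M μ) b' = b' := Prod.ext (torRed_self b'.1) rfl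
      have key := restrictOp_apply_of_injOn hinj g hW
      rw [e] at key
      rw [key]
    · rw [chiInt_of_not_intBond hb', zero_mul, zero_mul]
  have h := congrFun (congrArg (fun g => symOp M n c (gOp M n a g)) (hρ f)) b
  simpa only [neumannCubeG, LinearMap.comp_apply] using h

end LiftOp

/-! ## §10 ROWS OF THE LIFTED CUBE PROPAGATOR ON THE TORUS FAMILY OF RECORD: cube side `L^s` FIXED, volume `M_ν = 2L^{m_T}` FREE, programme N's constants -/

section Family

open Literature.MathematicalPhysics.QuantumFieldTheory.Balaban1983to89.B6Prop26Gluing (mulOp mulOp_apply ind ind_nonneg ind_le_one)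
open Literature.MathematicalPhysics.QuantumFieldTheory.Balaban1983to89.B6Prop26ReachTransplant (transplant)
open Literature.MathematicalPhysics.QuantumFieldTheory.King1986.Torus (blockOf tdistT)
open Literature.MathematicalPhysics.QuantumFieldTheory.Balaban1983to89.B11SectG (BlockNorm HasMaj RowSum)
open Literature.MathematicalPhysics.QuantumFieldTheory.Balaban1983to89.B6RandomWalk (Triangle254)
open Literature.MathematicalPhysics.QuantumFieldTheory.Balaban1983to89.B6UnitTorusCarrier (unitTorusGeo)
open Literature.MathematicalPhysics.QuantumFieldTheory.Balaban1983to89.B5SiteBridgeP12 (MP)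
open Summit.QuantumFields.YangMills.BalabanUVNodes.N15.VectorPiece (blkFine)

variable {L : ℕ}

/-- the doubled cube torus `M′_ν = 2L^s` divides the torus of record `M_ν = 2L^{m_T}` for `s ≤ m_T`. [folklore] -/
theorem MP_dvd_MP (hL : Odd L ∧ 1 < L) {s mT : ℕ} (hs : s ≤ mT) (K : ℕ) : ∀ μ : Fin (d + 1), MP (paramsOf d L s K hL) μ ∣ MP (paramsOf d L mT K hL) μ :=
  fun _ => mul_dvd_mul_left 2 (pow_dvd_pow L hs)

variable [NeZero L]

/-- ★★ **THE FAMILY TRANSFER THEOREM**: any operator `X′` of the side-`L^s` doubled torus whose output cut `χ_{□′} ∘ X′` carries programme N's letter `1_{□′}1_{□′}βe^{−δd′}` transplants to the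
torus of record (`M_ν = 2L^{m_T}`, `m_T ≥ s`, any `K`, any corner `c`) with the SAME letter in the big torus distance: `1_□(y)·1_□(y′)·β·e^{−δ|y − y′|_T}`.
[cite: Balaban1984PropagatorsII, (2.133) p.247 (shape), p.238 (T_□)] -/
theorem hasMaj_transplant_cube_family (hL : Odd L ∧ 1 < L) {s mT K : ℕ} (hs : s ≤ mT) (c : Tor (MP (paramsOf d L mT K hL)))
    (X' : Module.End ℝ (Tor (fine (L ^ K) (MP (paramsOf d L s K hL))) × Fin (d + 1) → ℝ)) {β δ : ℝ} (hβ : 0 ≤ β)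
    (hX : HasMaj (BlockNorm.ofBlocks (unitTorusGeo L K (MP (paramsOf d L s K hL))) (blkFine L K (MP (paramsOf d L s K hL))))
      (BlockNorm.ofBlocks (unitTorusGeo L K (MP (paramsOf d L s K hL))) (blkFine L K (MP (paramsOf d L s K hL))))
      (mulOp (chiCube (MP (paramsOf d L s K hL)) (L ^ K) (torRed (MP_dvd_MP hL hs K) c) (L ^ s)) ∘ₗ X')
      (fun y y' => ind ((cubeBlocks (MP (paramsOf d L s K hL)) (torRed (MP_dvd_MP hL hs K) c) (L ^ s) : Finset _) : Set _) y *
        ind ((cubeBlocks (MP (paramsOf d L s K hL)) (torRed (MP_dvd_MP hL hs K) c) (L ^ s) : Finset _) : Set _) y' *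
        (β * Real.exp (-(δ * tdistT (MP (paramsOf d L s K hL)) y y'))))) :
    HasMaj (BlockNorm.ofBlocks (unitTorusGeo L K (MP (paramsOf d L mT K hL))) (blkFine L K (MP (paramsOf d L mT K hL))))
      (BlockNorm.ofBlocks (unitTorusGeo L K (MP (paramsOf d L mT K hL))) (blkFine L K (MP (paramsOf d L mT K hL))))
      (transplant (cubeW (L ^ K) c (L ^ s)) (redBond (L ^ K) (MP_dvd_MP hL hs K)) X')
      (fun y y' => ind ((cubeBlocks (MP (paramsOf d L mT K hL)) c (L ^ s) : Finset _) : Set _) y *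
        ind ((cubeBlocks (MP (paramsOf d L mT K hL)) c (L ^ s) : Finset _) : Set _) y' *
        (β * Real.exp (-(δ * tdistT (MP (paramsOf d L mT K hL)) y y')))) := by
  have hM := MP_dvd_MP (d := d) hL hs K
  have hLpos : 0 < L := by have := hL.2; omega
  have hS : ∀ ν : Fin (d + 1), L ^ s ≤ MP (paramsOf d L s K hL) ν := fun ν => by show L ^ s ≤ 2 * L ^ s; omega
  have hS2' : ∀ ν : Fin (d + 1), 2 * L ^ s ≤ MP (paramsOf d L s K hL) ν := fun ν => le_rfl
  have hS2 : ∀ ν : Fin (d + 1), 2 * L ^ s ≤ MP (paramsOf d L mT K hL) ν := fun ν => by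
    show 2 * L ^ s ≤ 2 * L ^ mT; exact Nat.mul_le_mul_left 2 (Nat.pow_le_pow_right hLpos hs)
  have e1 : transplant (cubeW (L ^ K) c (L ^ s)) (redBond (L ^ K) hM) X' =
      transplant (cubeW (L ^ K) c (L ^ s)) (redBond (L ^ K) hM) (mulOp (chiCube (MP (paramsOf d L s K hL)) (L ^ K) (torRed hM c) (L ^ s)) ∘ₗ X') :=
    (transplant_mulOp_comp_of_eq_one (χ := chiCube (MP (paramsOf d L s K hL)) (L ^ K) (torRed hM c) (L ^ s)) (fun b hb => chiCube_redBond_of_mem hS hb) _).symm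
  rw [e1]
  have key := hasMaj_transplant_of_blockMap (g := unitTorusGeo L K (MP (paramsOf d L mT K hL))) (g' := unitTorusGeo L K (MP (paramsOf d L s K hL)))
    (blkFine L K (MP (paramsOf d L mT K hL))) (blkFine L K (MP (paramsOf d L s K hL))) (torRed hM) (cubeW (L ^ K) c (L ^ s)) (redBond (L ^ K) hM)
    ((cubeBlocks (MP (paramsOf d L mT K hL)) c (L ^ s) : Finset _) : Set _)
    (fun b _ => kingBlockOf_torRed (hM := hM) b.1) (fun b hb => Finset.mem_coe.mpr ((mem_cubeW b).mp hb)) (redBond_injOn_cubeW hS) (fun _ _ => ?_) hX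
  · refine key.mono fun y y' => le_of_eq ?_
    show ind (g := unitTorusGeo L K (MP (paramsOf d L mT K hL))) ((cubeBlocks (MP (paramsOf d L mT K hL)) c (L ^ s) : Finset _) : Set _) y *
        ind (g := unitTorusGeo L K (MP (paramsOf d L mT K hL))) ((cubeBlocks (MP (paramsOf d L mT K hL)) c (L ^ s) : Finset _) : Set _) y' *
        (ind (g := unitTorusGeo L K (MP (paramsOf d L s K hL))) ((cubeBlocks (MP (paramsOf d L s K hL)) (torRed hM c) (L ^ s) : Finset _) : Set _) (torRed hM y) *
          ind (g := unitTorusGeo L K (MP (paramsOf d L s K hL))) ((cubeBlocks (MP (paramsOf d L s K hL)) (torRed hM c) (L ^ s) : Finset _) : Set _) (torRed hM y') *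
          (β * Real.exp (-(δ * tdistT (MP (paramsOf d L s K hL)) (torRed hM y) (torRed hM y'))))) =
      ind (g := unitTorusGeo L K (MP (paramsOf d L mT K hL))) ((cubeBlocks (MP (paramsOf d L mT K hL)) c (L ^ s) : Finset _) : Set _) y *
        ind (g := unitTorusGeo L K (MP (paramsOf d L mT K hL))) ((cubeBlocks (MP (paramsOf d L mT K hL)) c (L ^ s) : Finset _) : Set _) y' *
        (β * Real.exp (-(δ * tdistT (MP (paramsOf d L mT K hL)) y y')))
    by_cases hy : y ∈ ((cubeBlocks (MP (paramsOf d L mT K hL)) c (L ^ s) : Finset _) : Set _)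
    · by_cases hy' : y' ∈ ((cubeBlocks (MP (paramsOf d L mT K hL)) c (L ^ s) : Finset _) : Set _)
      · have iy : ind (g := unitTorusGeo L K (MP (paramsOf d L s K hL))) ((cubeBlocks (MP (paramsOf d L s K hL)) (torRed hM c) (L ^ s) : Finset _) : Set _)
            (torRed hM y) = 1 := by
          unfold ind; rw [if_pos (Finset.mem_coe.mpr (torRed_mem_cubeBlocks hS (Finset.mem_coe.mp hy)))]
        have iy' : ind (g := unitTorusGeo L K (MP (paramsOf d L s K hL))) ((cubeBlocks (MP (paramsOf d L s K hL)) (torRed hM c) (L ^ s) : Finset _) : Set _)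
            (torRed hM y') = 1 := by
          unfold ind; rw [if_pos (Finset.mem_coe.mpr (torRed_mem_cubeBlocks hS (Finset.mem_coe.mp hy')))]
        have hd : tdistT (MP (paramsOf d L s K hL)) (torRed hM y) (torRed hM y') = tdistT (MP (paramsOf d L mT K hL)) y y' :=
          tdistT_torRed_eq hS2 hS2' (Finset.mem_coe.mp hy) (Finset.mem_coe.mp hy')
        rw [iy, iy', one_mul, one_mul, hd]
      · have i0 : ind (g := unitTorusGeo L K (MP (paramsOf d L mT K hL))) ((cubeBlocks (MP (paramsOf d L mT K hL)) c (L ^ s) : Finset _) : Set _) y' = 0 := by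
          unfold ind; rw [if_neg hy']
        rw [i0]; ring
    · have i0 : ind (g := unitTorusGeo L K (MP (paramsOf d L mT K hL))) ((cubeBlocks (MP (paramsOf d L mT K hL)) c (L ^ s) : Finset _) : Set _) y = 0 := by
        unfold ind; rw [if_neg hy]
      rw [i0]; ring
  · exact mul_nonneg (mul_nonneg (ind_nonneg _ _) (ind_nonneg _ _)) (mul_nonneg hβ (Real.exp_nonneg _))

/-- ★★★ **THE GLUING LETTER `hGc` OF THE LIFTED NEUMANN CUBE PROPAGATOR ON THE TORUS OF RECORD, UNIFORM IN THE VOLUME**: for odd `L > 1`, `a > 0` there are `δ, β > 0` (N-IIIb's, for the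
doubled tori) such that for EVERY cube exponent `s`, EVERY volume exponent `m_T ≥ s`, every `K ≥ 1` and every block-aligned cube `□ + c` of side `L^s` in `Tor (fine (L^K) M)`,
`M_ν = 2L^{m_T}`: `χ_□ ∘ G^{↑}(□ + c) ≤ 1_□(y)·1_□(y′)·β·e^{−δ|y − y′|_T}` blockwise. [cite: Balaban1984PropagatorsII, (2.133) p.247 (shape), (2.37) p.229, p.238 (T_□);
Balaban1984PropagatorsI, Prop. 1.2 (1.110) p.35] -/
theorem hasMaj_chiCube_liftCubeG (hL : Odd L ∧ 1 < L) {a : ℝ} (ha : 0 < a) :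
    ∃ δ β : ℝ, 0 < δ ∧ 0 < β ∧ ∀ (s mT K : ℕ) (hs : s ≤ mT) (hK : 1 ≤ K) (c : Tor (MP (paramsOf d L mT K hL))),
      HasMaj (BlockNorm.ofBlocks (unitTorusGeo L K (MP (paramsOf d L mT K hL))) (blkFine L K (MP (paramsOf d L mT K hL))))
        (BlockNorm.ofBlocks (unitTorusGeo L K (MP (paramsOf d L mT K hL))) (blkFine L K (MP (paramsOf d L mT K hL))))
        (mulOp (chiCube (MP (paramsOf d L mT K hL)) (L ^ K) c (L ^ s)) ∘ₗ liftCubeG (L ^ K) (MP_dvd_MP hL hs K) c (L ^ s) a)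
        (fun y y' => ind ((cubeBlocks (MP (paramsOf d L mT K hL)) c (L ^ s) : Finset _) : Set _) y *
          ind ((cubeBlocks (MP (paramsOf d L mT K hL)) c (L ^ s) : Finset _) : Set _) y' *
          (β * Real.exp (-(δ * tdistT (MP (paramsOf d L mT K hL)) y y')))) := by
  obtain ⟨δ, β, hδ, hβ, H⟩ := hasMaj_chiCube_neumannCubeG (d := d) hL ha
  refine ⟨δ, β, hδ, hβ, fun s mT K hs hK c => ?_⟩
  rw [liftCubeG_eq_liftOp, mulOp_chiCube_comp_liftOp]
  exact hasMaj_transplant_cube_family hL hs c _ hβ.le (H s K hK (torRed (MP_dvd_MP hL hs K) c))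

/-- ★★★ **ENTRY 1 (`hDc`): the forward-difference row `χ_□ ∘ ∇_ν ∘ G^{↑}(□ + c) ≤ 1_□1_□βe^{−δd}`** on the torus of record (`∇_ν = ρ(sD_ν L^K)`, N-IIIc's constants, uniform in the
volume) — by the DESCENT of `∇_ν` (`symbOp_sD_comp_pullVR`). [cite: Balaban1984PropagatorsII, (2.133)–(2.134) p.247 (shape); Balaban1984PropagatorsI, Prop. 1.2 (1.110) p.35] -/
theorem hasMaj_chiCube_grad_liftCubeG (hL : Odd L ∧ 1 < L) {a : ℝ} (ha : 0 < a) :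
    ∃ δ β : ℝ, 0 < δ ∧ 0 < β ∧ ∀ (s mT K : ℕ) (hs : s ≤ mT) (hK : 1 ≤ K) (c : Tor (MP (paramsOf d L mT K hL))) (ν : Fin (d + 1)),
      HasMaj (BlockNorm.ofBlocks (unitTorusGeo L K (MP (paramsOf d L mT K hL))) (blkFine L K (MP (paramsOf d L mT K hL))))
        (BlockNorm.ofBlocks (unitTorusGeo L K (MP (paramsOf d L mT K hL))) (blkFine L K (MP (paramsOf d L mT K hL))))
        (mulOp (chiCube (MP (paramsOf d L mT K hL)) (L ^ K) c (L ^ s)) ∘ₗ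
          symbOp (MP (paramsOf d L mT K hL)) (L ^ K) (sD (MP (paramsOf d L mT K hL)) (L ^ K) ν ((L ^ K : ℕ) : ℝ)) ∘ₗ
          liftCubeG (L ^ K) (MP_dvd_MP hL hs K) c (L ^ s) a)
        (fun y y' => ind ((cubeBlocks (MP (paramsOf d L mT K hL)) c (L ^ s) : Finset _) : Set _) y *
          ind ((cubeBlocks (MP (paramsOf d L mT K hL)) c (L ^ s) : Finset _) : Set _) y' *
          (β * Real.exp (-(δ * tdistT (MP (paramsOf d L mT K hL)) y y')))) := by
  obtain ⟨δ, β, hδ, hβ, H⟩ := hasMaj_chiCube_grad_neumannCubeG (d := d) hL ha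
  refine ⟨δ, β, hδ, hβ, fun s mT K hs hK c ν => ?_⟩
  rw [liftCubeG_eq_liftOp, comp_liftOp_of_comm (L ^ K) (MP_dvd_MP hL hs K) c (L ^ s) (symbOp_sD_comp_pullVR (L ^ K) (MP_dvd_MP hL hs K) ν _),
    mulOp_chiCube_comp_liftOp]
  exact hasMaj_transplant_cube_family hL hs c _ hβ.le (H s K hK (torRed (MP_dvd_MP hL hs K) c) ν)

/-- ★★ **THE NONLOCAL ROW `hNc` FOR dag-n15-c's SPLIT (N-IIj ∕ FILE 63 (d))**: `χ_□ ∘ V ∘ G^{↑}(□ + c) ≤ 1_□1_□·(2^{d+1}C₁(Ce^{δ₀})c_r)·e^{−ρ|y−y′|_T}` with `V = ∂Π∂*` the Landau term OF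
THE TORUS OF RECORD (its DESCENT `landauRe_comp_pullVR` moves it inside the lift; N-IIi on the doubled torus), for any admissible row-sum data `(σ, c_r)` of the small torus
and `ρ ≤ δ₀`, `ρ + σ ≤ δ₁`. [cite: Balaban1984PropagatorsII, (2.37) p.229, (2.133)–(2.134) p.247 (shapes); Balaban1984PropagatorsI, (1.126)–(1.128) p.38] -/
theorem hasMaj_chiCube_landauRe_liftCubeG (hL : Odd L ∧ 1 < L) {a : ℝ} (ha : 0 < a) :
    ∃ δ₀ C δ₁ C₁ : ℝ, 0 < δ₀ ∧ 0 < C ∧ 0 < δ₁ ∧ 0 < C₁ ∧ ∀ (s mT K : ℕ) (hs : s ≤ mT) (hK : 1 ≤ K) (c : Tor (MP (paramsOf d L mT K hL))) {ρ σ cr : ℝ}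
      (hrow : RowSum (unitTorusGeo L K (MP (paramsOf d L s K hL))) σ cr) (hρ : 0 ≤ ρ) (hρδ : ρ ≤ δ₀) (hρσ : ρ + σ ≤ δ₁),
      HasMaj (BlockNorm.ofBlocks (unitTorusGeo L K (MP (paramsOf d L mT K hL))) (blkFine L K (MP (paramsOf d L mT K hL))))
        (BlockNorm.ofBlocks (unitTorusGeo L K (MP (paramsOf d L mT K hL))) (blkFine L K (MP (paramsOf d L mT K hL))))
        (mulOp (chiCube (MP (paramsOf d L mT K hL)) (L ^ K) c (L ^ s)) ∘ₗ landauRe (MP (paramsOf d L mT K hL)) (L ^ K) ∘ₗ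
          liftCubeG (L ^ K) (MP_dvd_MP hL hs K) c (L ^ s) a)
        (fun y y' => ind ((cubeBlocks (MP (paramsOf d L mT K hL)) c (L ^ s) : Finset _) : Set _) y *
          ind ((cubeBlocks (MP (paramsOf d L mT K hL)) c (L ^ s) : Finset _) : Set _) y' *
          (2 ^ (d + 1) * (C₁ * (C * Real.exp δ₀) * cr) * Real.exp (-(ρ * tdistT (MP (paramsOf d L mT K hL)) y y')))) := by
  obtain ⟨δ₀, C, hδ₀, hC, HG⟩ := hasMaj_gOp (d := d) hL ha
  obtain ⟨δ₁, C₁, hδ₁, hC₁, HV⟩ := hasMaj_landauRe (d := d) (L := L)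
  refine ⟨δ₀, C, δ₁, C₁, hδ₀, hC, hδ₁, hC₁, fun s mT K hs hK c ρ σ cr hrow hρ hρδ hρσ => ?_⟩
  have hM' : ∀ ν, MP (paramsOf d L s K hL) ν = 2 * L ^ s := fun ν => rfl
  have hcr : 0 ≤ cr := hrow.nonneg (torRed (MP_dvd_MP hL hs K) c)
  have h' := hasMaj_chiCube_comp_neumannCubeG (c := torRed (MP_dvd_MP hL hs K) c) (S := L ^ s) (a := a) hM' (B6UnitTorusCarrier.triangle254_unitTorusGeo L K _) hrow hC.le hδ₀.le hC₁.le
    hρ hρδ hρσ (HV K (L ^ K) (MP (paramsOf d L s K hL))) (HG s K hK)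
  rw [liftCubeG_eq_liftOp, comp_liftOp_of_comm (L ^ K) (MP_dvd_MP hL hs K) c (L ^ s) (landauRe_comp_pullVR (L ^ K) (MP_dvd_MP hL hs K)), mulOp_chiCube_comp_liftOp]
  exact hasMaj_transplant_cube_family hL hs c _ (by positivity) h'

/-- ★★★ **THE EXACT LOCALITY ON THE TORUS FAMILY OF RECORD** (FILE 45's `hloc`): `M_h ∘ Δ_a ∘ G^{↑}(□ + c) = M_h` for every `h` supported on the interior bonds of the side-`L^s` cube
`□ + c` of `Tor (fine (L^K) M)`, `M_ν = 2L^{m_T}`, `m_T ≥ s`, `a > 0`. [cite: Balaban1984PropagatorsII, (2.38) p.229, (2.91) p.239] -/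
theorem mulOp_comp_deltaOp_comp_liftCubeG_family (hL : Odd L ∧ 1 < L) {a : ℝ} (ha : 0 < a) {s mT K : ℕ} (hs : s ≤ mT) (c : Tor (MP (paramsOf d L mT K hL)))
    {h : Tor (fine (L ^ K) (MP (paramsOf d L mT K hL))) × Fin (d + 1) → ℝ} (hh : ∀ b, h b ≠ 0 → b ∈ intBonds (MP (paramsOf d L mT K hL)) (L ^ K) c (L ^ s)) :
    mulOp h ∘ₗ deltaOp (MP (paramsOf d L mT K hL)) (L ^ K) a ∘ₗ liftCubeG (L ^ K) (MP_dvd_MP hL hs K) c (L ^ s) a = mulOp h := by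
  have hLpos : 0 < L := by have := hL.2; omega
  exact mulOp_comp_deltaOp_comp_liftCubeG (L ^ K) (MP_dvd_MP hL hs K) c (L ^ s) a (fun _ => rfl) (Nat.one_le_pow K L hLpos) ha hh

end Family

end Summit.QuantumFields.YangMills.BalabanUVNodes.N15.TwoGrid

end
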